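import Summits.BirchSwinnertonDyer.BirchSwinnertonDyer.Theorems.CumulativeHeegnerLeopoldtCumulativeHeegnerInclusionAtThreeTemperedRigidity
import Mathlib.Analysis.Normed.Ring.InfiniteSum
import HarnessLib

/-!
# Crux K1 `CumulativeHeegnerInclusionAtThree` (stmt-BirchSwinnertonDyer-24198), stub A = crux stmt-26896:
# TEMPERED RIGIDITY WITH A MULTIPLIER — a reciprocity identity `Φ = m · ℒ` on the BDP interpolation range, with
# `Φ`, `m` series over `ℂ_p` of positive radius (tempered), pins `Φ` as the Cauchy product `m ⋆ L`

Width seat `bsd-line-chl-k1-p1-w2` (g3) of the K1 line `birth` (route `CumulativeHeegnerLeopoldt`, rev 5); sequel of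
`…TemperedRigidity` (p626716, same namespace). Helper toward stub A (`--supports stmt-BirchSwinnertonDyer-24198`);
THEOREMS ONLY (no definition, no named fact, no `sorry`). BSD is not proved by any of this; no summit statement is
proved by this file.

## Why

The K1 lead's stub (c♮) for a tempered A-line (TEMPERED-LINE-VIABILITY-g4 §2) is a reciprocity law
`Col♮(loc_𝔭 κ♮) · m(T) = ℒ_𝔭^{BDP} · unit` with an explicit order-1 MULTIPLIER `m`, "pinned on the type-`(n,-n)` range".
`…TemperedRigidity.eq_coeff_of_isBDPLFunction_of_hasSum` pins a tempered series having Castella's values themselves;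
this file pins the multiplier shape: if `Φ(x_φ) = m(x_φ) · [Castella's value at φ]` at every interpolation point inside
the discs, then `Φ = m ⋆ L` coefficientwise (`L` the frame's bounded BDP function), by the Cauchy product inside both
discs and `…TemperedRigidity.eq_of_hasSum_bdpRange`.

## What is proved

* §4a (any complete nontrivially normed field): `summable_norm_mul_pow_of_lt` (norm-summability strictly inside a
  positive-radius bound), `norm_cauchyProduct_mul_pow_le` (the Cauchy product of two positive-radius series has positive
  radius `min ρ ρ' / 2`), `hasSum_cauchyProduct` (its value is the product of the values inside both discs).
* §4b at the BDP frame (odd `p`, `K` imaginary quadratic, `κ` anticyclotomic with topological generator `γ`):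
  **`eq_cauchyProduct_of_isBDPLFunction_of_hasSum_mul`** — `IsBDPLFunction ι 𝔭 κ γ f Ω_K Ω_p L`, `Φ`, `m` of positive
  radius with `Φ(x_φ) = m(x_φ)·ι⁻¹(bdpInterpolationValue …)·Ω_p^{4n}` at the interpolation points inside the discs ⟹
  `Φ_n = ∑_{k+l=n} m_k [T^l]L`.

References: [Castella2018] Thm. 3.1 (arXiv:1704.06608 p. 9); [Greenberg1987] §2 (character supply);
[Cassels1986] Ch. 4 (power series over complete fields).
-/

noncomputable section

-- D-0017: single-problem summit, `Summit.BirchSwinnertonDyer.BirchSwinnertonDyer.…` repeats a namespace BY DESIGN.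
set_option linter.dupNamespace false
set_option autoImplicit false

open scoped Classical Topology

open Filter Finset NumberField IsDedekindDomain Field PowerSeries
open Literature.NumberTheory.EllipticCurves
open Literature.NumberTheory.GaloisRepresentations
open Summit.BirchSwinnertonDyer.Rank1Residual.X11b
open Summit.BirchSwinnertonDyer.Rank1Residual.X11b.Halves

namespace Summit.BirchSwinnertonDyer.BirchSwinnertonDyer.Theorems.CumulativeHeegnerInclusionAtThreeTemperedRigidity

/-! ### §4 Reciprocity with a tempered MULTIPLIER: `Φ = m · L` on the BDP range pins `Φ = m ⋆ L` -/

section CauchyProduct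

variable {𝕜 : Type*} [NontriviallyNormedField 𝕜] [CompleteSpace 𝕜]

omit [CompleteSpace 𝕜] in
/-- Inside the disc of a positive-radius bound the terms are NORM-summable: `‖c_n‖ ρ^n ≤ C` and `‖x‖ < ρ` give
`∑ ‖c_n x^n‖ < ∞` (geometric domination by `(‖x‖/ρ)^n`). [folklore] -/
theorem summable_norm_mul_pow_of_lt {c : ℕ → 𝕜} {ρ C : ℝ} (hρ : 0 < ρ) (hc : ∀ n, ‖c n‖ * ρ ^ n ≤ C)
    {x : 𝕜} (hx : ‖x‖ < ρ) : Summable fun n ↦ ‖c n * x ^ n‖ := by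
  have hC0 : 0 ≤ C := (mul_nonneg (norm_nonneg _) (pow_nonneg hρ.le _)).trans (hc 0)
  have hq0 : 0 ≤ ‖x‖ / ρ := div_nonneg (norm_nonneg _) hρ.le
  have hq : ‖x‖ / ρ < 1 := (div_lt_one hρ).mpr hx
  refine Summable.of_nonneg_of_le (fun n ↦ norm_nonneg _) (fun n ↦ ?_)
    ((summable_geometric_of_lt_one hq0 hq).mul_left C)
  rw [norm_mul, norm_pow, div_pow, mul_div_assoc', le_div_iff₀ (pow_pos hρ _)]
  calc ‖c n‖ * ‖x‖ ^ n * ρ ^ n = ‖c n‖ * ρ ^ n * ‖x‖ ^ n := by ring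
    _ ≤ C * ‖x‖ ^ n := mul_le_mul_of_nonneg_right (hc n) (pow_nonneg (norm_nonneg _) _)

omit [CompleteSpace 𝕜] in
/-- **The Cauchy product of two positive-radius series has positive radius**: with `ρ₀ = min ρ ρ'`,
`‖∑_{k+l=n} c_k c'_l‖ (ρ₀/2)^n ≤ C C'` (crude bound `(n+1)/2^n ≤ 1`, valid in any normed field). [folklore] -/
theorem norm_cauchyProduct_mul_pow_le {c c' : ℕ → 𝕜} {ρ C ρ' C' : ℝ} (hρ : 0 < ρ)
    (hc : ∀ n, ‖c n‖ * ρ ^ n ≤ C) (hρ' : 0 < ρ') (hc' : ∀ n, ‖c' n‖ * ρ' ^ n ≤ C') (n : ℕ) :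
    ‖∑ kl ∈ antidiagonal n, c kl.1 * c' kl.2‖ * (min ρ ρ' / 2) ^ n ≤ C * C' := by
  have hmin : 0 < min ρ ρ' := lt_min hρ hρ'
  have hC0 : 0 ≤ C := (mul_nonneg (norm_nonneg _) (pow_nonneg hρ.le _)).trans (hc 0)
  have hC'0 : 0 ≤ C' := (mul_nonneg (norm_nonneg _) (pow_nonneg hρ'.le _)).trans (hc' 0)
  -- each term: `‖c_k c'_l‖ ρ₀^n ≤ C C'`
  have hterm : ∀ kl ∈ antidiagonal n, ‖c kl.1 * c' kl.2‖ * (min ρ ρ') ^ n ≤ C * C' := by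
    intro kl hkl
    have hn : kl.1 + kl.2 = n := mem_antidiagonal.mp hkl
    rw [← hn, pow_add, norm_mul]
    calc ‖c kl.1‖ * ‖c' kl.2‖ * ((min ρ ρ') ^ kl.1 * (min ρ ρ') ^ kl.2)
        = (‖c kl.1‖ * (min ρ ρ') ^ kl.1) * (‖c' kl.2‖ * (min ρ ρ') ^ kl.2) := by ring
      _ ≤ C * C' := mul_le_mul (norm_mul_pow_le_of_le hmin.le (min_le_left _ _) hc _)
          (norm_mul_pow_le_of_le hmin.le (min_le_right _ _) hc' _)
          (mul_nonneg (norm_nonneg _) (pow_nonneg hmin.le _)) hC0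
  -- sum: `‖∑‖ ρ₀^n ≤ (n+1) C C'`, and `(n+1) (1/2)^n ≤ 1`
  have hsum : ‖∑ kl ∈ antidiagonal n, c kl.1 * c' kl.2‖ * (min ρ ρ') ^ n ≤ (n + 1) * (C * C') := by
    have h1 : ‖∑ kl ∈ antidiagonal n, c kl.1 * c' kl.2‖ ≤ ∑ kl ∈ antidiagonal n, ‖c kl.1 * c' kl.2‖ :=
      norm_sum_le _ _
    calc ‖∑ kl ∈ antidiagonal n, c kl.1 * c' kl.2‖ * (min ρ ρ') ^ n
        ≤ (∑ kl ∈ antidiagonal n, ‖c kl.1 * c' kl.2‖) * (min ρ ρ') ^ n :=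
          mul_le_mul_of_nonneg_right h1 (pow_nonneg hmin.le _)
      _ = ∑ kl ∈ antidiagonal n, ‖c kl.1 * c' kl.2‖ * (min ρ ρ') ^ n := Finset.sum_mul _ _ _
      _ ≤ ∑ kl ∈ antidiagonal n, C * C' := Finset.sum_le_sum hterm
      _ = (n + 1) * (C * C') := by
          rw [Finset.sum_const, Finset.Nat.card_antidiagonal, nsmul_eq_mul]; push_cast; ring
  have hhalf : ((n : ℝ) + 1) * (1 / 2) ^ n ≤ 1 := by
    rw [one_div, inv_pow, ← div_eq_mul_inv, div_le_one (pow_pos two_pos _)]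
    have : (n : ℝ) + 1 ≤ 2 ^ n := by
      have h := Nat.lt_two_pow_self (n := n)
      exact_mod_cast h
    exact this
  calc ‖∑ kl ∈ antidiagonal n, c kl.1 * c' kl.2‖ * (min ρ ρ' / 2) ^ n
      = ‖∑ kl ∈ antidiagonal n, c kl.1 * c' kl.2‖ * (min ρ ρ') ^ n * (1 / 2) ^ n := by
        rw [div_eq_mul_one_div, mul_pow]; ring
    _ ≤ (n + 1) * (C * C') * (1 / 2) ^ n :=
        mul_le_mul_of_nonneg_right hsum (pow_nonneg (by norm_num) _)
    _ = ((n : ℝ) + 1) * (1 / 2) ^ n * (C * C') := by ring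
    _ ≤ 1 * (C * C') := mul_le_mul_of_nonneg_right hhalf (mul_nonneg hC0 hC'0)
    _ = C * C' := one_mul _

/-- **Value of the Cauchy product** inside both discs: `∑ (c ⋆ c')_n x^n = (∑ c_n x^n)(∑ c'_n x^n)` for
`‖x‖ < min ρ ρ'` (Mertens / Cauchy product of norm-summable series in a complete normed field). [folklore] -/
theorem hasSum_cauchyProduct {c c' : ℕ → 𝕜} {ρ C ρ' C' : ℝ} (hρ : 0 < ρ) (hc : ∀ n, ‖c n‖ * ρ ^ n ≤ C)
    (hρ' : 0 < ρ') (hc' : ∀ n, ‖c' n‖ * ρ' ^ n ≤ C') {x : 𝕜} (hx : ‖x‖ < ρ) (hx' : ‖x‖ < ρ') :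
    HasSum (fun n ↦ (∑ kl ∈ antidiagonal n, c kl.1 * c' kl.2) * x ^ n)
      ((∑' n, c n * x ^ n) * ∑' n, c' n * x ^ n) := by
  have hf := summable_norm_mul_pow_of_lt hρ hc hx
  have hg := summable_norm_mul_pow_of_lt hρ' hc' hx'
  have hprod := tsum_mul_tsum_eq_tsum_sum_antidiagonal_of_summable_norm hf hg
  have hsum : Summable fun n ↦ ∑ kl ∈ antidiagonal n, c kl.1 * x ^ kl.1 * (c' kl.2 * x ^ kl.2) :=
    (summable_norm_sum_mul_antidiagonal_of_summable_norm hf hg).of_norm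
  have hfun : (fun n ↦ (∑ kl ∈ antidiagonal n, c kl.1 * c' kl.2) * x ^ n) =
      fun n ↦ ∑ kl ∈ antidiagonal n, c kl.1 * x ^ kl.1 * (c' kl.2 * x ^ kl.2) := by
    funext n
    rw [Finset.sum_mul]
    refine Finset.sum_congr rfl fun kl hkl ↦ ?_
    rw [← mem_antidiagonal.mp hkl, pow_add]; ring
  rw [hfun, hprod]
  exact hsum.hasSum

end CauchyProduct

section FrameMultiplier

variable {p : ℕ} [Fact p.Prime] {K : Type} [Field K] [NumberField K] {N : ℕ}
  {ι : PadicAlgCl p ≃+* ℂ} {𝔭 : HeightOneSpectrum (𝓞 K)} {κ : ZpExtension K p}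
  {γ : absoluteGaloisGroup K} {f : CuspForm (CongruenceSubgroup.Gamma0 N) 2} {ΩK : ℂ} {Ωp : ℂ_[p]}

/-- **A reciprocity law WITH A TEMPERED MULTIPLIER pins its left-hand side.** Odd `p`; `K` imaginary quadratic;
`κ` anticyclotomic with topological generator `γ`; `L ∈ R₀⟦T⟧` with `IsBDPLFunction ι 𝔭 κ γ f Ω_K Ω_p L`. Let `Φ`
and `m` be series over `ℂ_p` of positive radii `ρ_Φ`, `ρ_m` (e.g. tempered) such that at every interpolation point
`x_φ = φ̂(γ) - 1` inside the relevant discs, `Φ(x_φ) = m(x_φ) · [Castella's value at φ]`. Then `Φ` is the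
Cauchy product `m ⋆ L` coefficientwise: `Φ_n = ∑_{k+l=n} m_k [T^l]L`. This is the kernel form of the shape
«`Col♮(loc_𝔭 κ♮) · m = ℒ_𝔭^{BDP}`-type identity with an explicit order-1 multiplier, pinned on the type-`(n,-n)`
range» of the K1 lead's TEMPERED-LINE-VIABILITY (c♮) (here written `Φ = m · ℒ` to avoid dividing by `m`).
[cite: Castella2018, Thm. 3.1 (arXiv:1704.06608 p. 9)] [cite: Greenberg1987, §2] -/
theorem eq_cauchyProduct_of_isBDPLFunction_of_hasSum_mul (hp2 : p ≠ 2) (hK : IsImaginaryQuadratic K)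
    (hκ : κ.IsAnticyclotomic) (hγ : κ.IsTopGenerator γ) {L : UnrSeries p}
    (hL : IsBDPLFunction ι 𝔭 κ γ f ΩK Ωp L) {Φ m : ℕ → ℂ_[p]} {ρΦ CΦ ρm Cm : ℝ} (hρΦ : 0 < ρΦ)
    (hΦ : ∀ n, ‖Φ n‖ * ρΦ ^ n ≤ CΦ) (hρm : 0 < ρm) (hm : ∀ n, ‖m n‖ * ρm ^ n ≤ Cm)
    (h : ∀ (φ : HeckeCharacter K) (n : ℕ), 0 < n → (∀ v : HeightOneSpectrum (𝓞 K), φ.IsUnramifiedAt v) →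
      φ.HasInfinityType (fun _ ↦ (n : ℤ)) (fun _ ↦ -(n : ℤ)) →
      ∀ r : FramedGaloisRep K (PadicAlgCl p) 1, IsPAdicAvatarOf ι φ r → FactorsThroughZp κ r →
      ‖avatarValueAt r γ - 1‖ < ρΦ → ‖avatarValueAt r γ - 1‖ < ρm →
      ∃ vm : ℂ_[p], HasSum (fun k ↦ m k * (avatarValueAt r γ - 1) ^ k) vm ∧
        HasSum (fun k ↦ Φ k * (avatarValueAt r γ - 1) ^ k)
          (vm * (((ι.symm (bdpInterpolationValue p f 𝔭 φ n ΩK) : PadicAlgCl p) : ℂ_[p]) * Ωp ^ (4 * n)))) :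
    Φ = fun n ↦ ∑ kl ∈ antidiagonal n, m kl.1 * ((PowerSeries.coeff kl.2 L : unrIntegers p) : ℂ_[p]) := by
  -- `m ⋆ L` has positive radius `min ρm 1 / 2`
  have hrad := norm_cauchyProduct_mul_pow_le hρm hm one_pos (norm_coeff_mul_one_pow_le L)
  have hρ' : 0 < min ρm 1 / 2 := by positivity
  refine eq_of_hasSum_bdpRange (ι := ι) hp2 hK hκ hγ hρΦ hΦ hρ' hrad ?_
  intro φ n hn hunr hinf r hr hfac hlt hlt'
  have hltm : ‖avatarValueAt r γ - 1‖ < ρm :=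
    hlt'.trans_le ((half_le_self (le_of_lt (lt_min hρm one_pos))).trans (min_le_left _ _))
  have hlt1 : ‖avatarValueAt r γ - 1‖ < 1 :=
    hlt'.trans_le ((half_le_self (le_of_lt (lt_min hρm one_pos))).trans (min_le_right _ _))
  obtain ⟨vm, hvm, hvΦ⟩ := h φ n hn hunr hinf r hr hfac hlt hltm
  refine ⟨_, hvΦ, ?_⟩
  have hLval := hL.hasValueAt hn hunr hinf hr hfac
  have hcp := hasSum_cauchyProduct hρm hm one_pos (norm_coeff_mul_one_pow_le L) hltm hlt1
  rwa [hvm.tsum_eq, hLval.tsum_eq] at hcp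

end FrameMultiplier

end Summit.BirchSwinnertonDyer.BirchSwinnertonDyer.Theorems.CumulativeHeegnerInclusionAtThreeTemperedRigidity

end
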